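import Literature.NumberTheory.LFunctions.DeBruijnHLogDerivSeries
import Literature.NumberTheory.LFunctions.DeBruijnHZeroProofs
import Literature.NumberTheory.LFunctions.RiemannXiProofs
import Literature.NumberTheory.LFunctions.ZetaZerosProofs
import Mathlib.SetTheory.Cardinal.NatCard
import HarnessLib

/-!
# The Hadamard product of Riemann's `ξ` and the partial-fraction series of `ξ'/ξ`

Trunk T-ANT (`NumberTheory/LFunctions`), family RH.  The classical genus-one factorisation
(Hadamard 1893; Davenport Ch. 12; Titchmarsh §2.12; Edwards §2.2–2.3)

  `ξ(s) = ξ(½) ∏ₙ (1 − (s−½)²/(ρₙ−½)²) = ξ(0) ∏_ρ (1 − s/ρ)`  (zeros paired `ρ ↔ 1−ρ`),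
  `ξ'(s)/ξ(s) = ∑_ρ 1/(s − ρ)`                                   (same pairing),

obtained here at once from two PROVED results of the tree: the grouped Hadamard product of
de Bruijn's `H_t` (`Literature.NumberTheory.LFunctions.exists_isHadamardSeq`, `Literature.NumberTheory.LFunctions.IsHadamardSeq.logDeriv_eq` in
`DeBruijnHLogDerivSeries.lean`, from Hadamard's theorem in genus zero,
`Literature.Analysis.Complex.hadamard_genus_zero_holds`, applied to the even lift of `H_t`) and
`H₀(z) = ξ(½ + iz/2)/8` (`Literature.NumberTheory.LFunctions.deBruijnH_zero_eq_holds`).  With `z = −i(2s−1)` (`Literature.NumberTheory.LFunctions.xiToH`):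

* `Literature.NumberTheory.LFunctions.riemannXi_eq_deBruijnH` — `ξ(s) = 8 H₀(−i(2s−1))`, `ξ(½) = 8H₀(0) ≠ 0`;
* `Literature.NumberTheory.LFunctions.IsHadamardSeq.hasProd_riemannXi`, `riemannXi_eq_mul_tprod` — for every Hadamard sequence
  `b` of `H₀` (`∑‖bₙ‖ < ∞`): `ξ(s)/ξ(½) = ∏ₙ (1 − bₙ(2s−1)²)`;
* `Literature.IsHadamardSeq.xiZero b n = ρₙ := ½ + (1/(4bₙ))^{1/2}` — `1 − bₙ(2s−1)² =
  −4bₙ (s−ρₙ)(s−(1−ρₙ))` (`factor_eq_mul`); `ρₙ`, `1−ρₙ` are zeros of `ξ`, i.e. nontrivial zeros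
  of `ζ` (`riemannZeta_xiZero`: `ζ(ρₙ) = 0`, `0 < Re ρₙ < 1`); conversely every zero of `ξ` kills
  a factor (`riemannXi_eq_mul_tprod`), and multiplicities are identified at the level of `H₀` by
  the tree's `IsHadamardSeq.analyticOrderAt_eq_mult` (`#{n : 1 + bₙz² = 0} = ord_z H₀`), so
  `{ρₙ, 1−ρₙ : bₙ ≠ 0}` is the multiset of nontrivial zeros of `ζ` with multiplicity (the
  transfer of the order along the affine map `xiToH` is not restated here);
* `Literature.NumberTheory.LFunctions.IsHadamardSeq.logDeriv_riemannXi_eq_tsum`, `logDeriv_riemannXi_eq_tsum_pairs`,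
  `re_logDeriv_riemannXi_eq_tsum` — at every `s` with `ξ(s) ≠ 0`:
  `ξ'/ξ(s) = ∑ₙ −4bₙ(2s−1)/(1−bₙ(2s−1)²) = ∑ₙ [1/(s−ρₙ) + 1/(s−(1−ρₙ))]` (absolutely convergent),
  and its real part termwise, with `Re 1/(s−ρ) = (σ−β)/|s−ρ|²` (`re_inv_sub_eq`);
  `hasSum_log_norm_factors(_sub)` — `log|ξ(s)| − log|ξ(s')| = ∑ₙ log|fₙ(s)/fₙ(s')|`;
* `Literature.NumberTheory.LFunctions.IsHadamardSeq.exists_perm_eq_conj`, `tsum_comp_conj_eq` — for every Hadamard sequence `b` of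
  any `H_t` there is a permutation `π` of `ℕ` with `b ∘ π = conj ∘ b` (the multiset of zeros is
  closed under `z ↦ z̄` with multiplicities, `analyticOrderAt_deBruijnH_conj`), so sums over the
  multiset may be re-indexed by `ρ ↦ 1 − ρ̄` — the pairing used with Booker's lemma
  [Trudgian 2011, Lemma 2.10].

These are the inputs "by the Weierstrass/Hadamard product … `∑_ρ Re 1/(s−ρ) = Re ζ'/ζ(s) + …`"
of Lehman's and Trudgian's lower bound for `∫ log|ζ(σ+it)| dσ` in Turing's method
[Trudgian 2011, (2.17)–(2.20)], of Li's `λₙ = ∑_ρ [1 − (1−1/ρ)ⁿ]`, and of explicit-formula work;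
combine with `Literature.NumberTheory.LFunctions.logDeriv_riemannXi_eq` (`RiemannXiLogDeriv.lean`:
`ξ'/ξ = 1/s + Γℝ'/Γℝ + ζ₁'/ζ₁`) to pass to `ζ'/ζ`.

## References

* H. Davenport, *Multiplicative Number Theory*, 3rd ed., Ch. 12, (1)–(10).
* E. C. Titchmarsh, *The Theory of the Riemann Zeta-Function*, 2nd ed., §2.12.
* D. H. J. Polymath, *Effective approximation of heat flow evolution of the Riemann ξ function…*,
  Res. Math. Sci. 6 (2019), §3 (grouped Hadamard product of `H_t`).  [Polymath2019]
* T. S. Trudgian, *Improvements to Turing's method*, Math. Comp. 80 (2011), §2.2.  [Trudgian2011]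
-/

noncomputable section

open Complex Filter Topology
open scoped ComplexConjugate

namespace Literature.NumberTheory.LFunctions

/-! ## `ξ(s) = 8 H₀(−i(2s−1))` -/

/-- The variable of de Bruijn's `H₀` corresponding to `s`: `s = ½ + iz/2 ⇔ z = −i(2s − 1)`.
[folklore] -/
def xiToH (s : ℂ) : ℂ := -I * (2 * s - 1)

/-- `½ + i·xiToH(s)/2 = s`. [folklore] -/
theorem half_add_I_mul_xiToH_div_two (s : ℂ) : 1 / 2 + I * xiToH s / 2 = s := by
  simp only [xiToH]
  ring_nf
  rw [I_sq]
  ring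

/-- `xiToH(s)² = −(2s−1)²`. [folklore] -/
theorem xiToH_sq (s : ℂ) : xiToH s ^ 2 = -(2 * s - 1) ^ 2 := by
  simp only [xiToH, mul_pow, neg_pow_two, I_sq]
  ring

/-- `xiToH(½) = 0`. [folklore] -/
theorem xiToH_one_half : xiToH (1 / 2) = 0 := by
  simp [xiToH]

/-- `xiToH` has derivative `−2i`. [folklore] -/
theorem hasDerivAt_xiToH (s : ℂ) : HasDerivAt xiToH (-2 * I) s := by
  have h : HasDerivAt (fun s : ℂ ↦ -I * (2 * s - 1)) (-I * (2 * 1)) s :=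
    (((hasDerivAt_id s).const_mul 2).sub_const 1).const_mul (-I)
  have e : xiToH = fun s : ℂ ↦ -I * (2 * s - 1) := rfl
  rw [e]
  convert h using 1
  ring

/-- **`ξ(s) = 8 H₀(−i(2s−1))`** (the tree's `Literature.NumberTheory.LFunctions.deBruijnH_zero_eq_holds`:
`H₀(z) = ξ(½ + iz/2)/8`). [cite: RodgersTao2020, eq. (3)] -/
theorem riemannXi_eq_deBruijnH (s : ℂ) : riemannXi s = 8 * deBruijnH 0 (xiToH s) := by
  rw [deBruijnH_zero_eq_holds (xiToH s), half_add_I_mul_xiToH_div_two]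
  ring

/-- `ξ(½) = 8 H₀(0)`. [folklore] -/
theorem riemannXi_one_half_eq : riemannXi (1 / 2) = 8 * deBruijnH 0 0 := by
  rw [riemannXi_eq_deBruijnH, xiToH_one_half]

/-- `ξ(½) ≠ 0` (indeed `H₀(0) > 0`). [folklore] -/
theorem riemannXi_one_half_ne_zero : riemannXi (1 / 2) ≠ 0 := by
  rw [riemannXi_one_half_eq]
  exact mul_ne_zero (by norm_num) (deBruijnH_apply_zero_ne_zero 0)

/-! ## The Hadamard product of `ξ` -/

namespace IsHadamardSeq

variable {b : ℕ → ℂ}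

/-- **Hadamard product of `ξ`** (grouped over the pairs `{ρ, 1−ρ}`): for a Hadamard sequence `b`
of `H₀`, `ξ(s)/ξ(½) = ∏ₙ (1 − bₙ (2s−1)²)` for every `s`. [cite: Polymath2019, §3] -/
theorem hasProd_riemannXi (h : IsHadamardSeq 0 b) (s : ℂ) :
    HasProd (fun n ↦ 1 - b n * (2 * s - 1) ^ 2) (riemannXi s / riemannXi (1 / 2)) := by
  have hp := h.hasProd (xiToH s)
  rw [riemannXi_eq_deBruijnH, riemannXi_one_half_eq,
    mul_div_mul_left _ _ (by norm_num : (8 : ℂ) ≠ 0)]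
  convert hp using 2 with n
  rw [xiToH_sq]; ring

/-- `ξ(s) = ξ(½) ∏ₙ (1 − bₙ (2s−1)²)`. [cite: Polymath2019, §3] -/
theorem riemannXi_eq_mul_tprod (h : IsHadamardSeq 0 b) (s : ℂ) :
    riemannXi s = riemannXi (1 / 2) * ∏' n, (1 - b n * (2 * s - 1) ^ 2) := by
  rw [(h.hasProd_riemannXi s).tprod_eq, mul_div_cancel₀ _ riemannXi_one_half_ne_zero]

/-- A vanishing factor gives a zero of `ξ`. [folklore] -/
theorem riemannXi_eq_zero_of_factor (h : IsHadamardSeq 0 b) {s : ℂ} {n : ℕ}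
    (hn : 1 - b n * (2 * s - 1) ^ 2 = 0) : riemannXi s = 0 := by
  have : 1 + b n * xiToH s ^ 2 = 0 := by rw [xiToH_sq]; linear_combination hn
  rw [riemannXi_eq_deBruijnH, h.eq_zero_of_factor this, mul_zero]

/-- Where `ξ ≠ 0`, no factor vanishes. [folklore] -/
theorem factor_ne_zero' (h : IsHadamardSeq 0 b) {s : ℂ} (hs : riemannXi s ≠ 0) (n : ℕ) :
    1 - b n * (2 * s - 1) ^ 2 ≠ 0 := fun hn ↦ hs (h.riemannXi_eq_zero_of_factor hn)

/-- **Logarithm of the Hadamard product**: at every `s` with `ξ(s) ≠ 0`,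
`log|ξ(s)/ξ(½)| = ∑ₙ log|1 − bₙ(2s−1)²|` (unconditionally convergent). [folklore] -/
theorem hasSum_log_norm_factors (h : IsHadamardSeq 0 b) {s : ℂ} (hs : riemannXi s ≠ 0) :
    HasSum (fun n ↦ Real.log ‖1 - b n * (2 * s - 1) ^ 2‖)
      (Real.log ‖riemannXi s / riemannXi (1 / 2)‖) := by
  have hp := h.hasProd_riemannXi s
  have hL : riemannXi s / riemannXi (1 / 2) ≠ 0 := div_ne_zero hs riemannXi_one_half_ne_zero
  have hcont : ContinuousAt (fun w : ℂ ↦ Real.log ‖w‖) (riemannXi s / riemannXi (1 / 2)) :=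
    (continuous_norm.continuousAt).log (norm_ne_zero_iff.2 hL)
  have ht := hcont.tendsto.comp hp
  refine (ht.congr fun S ↦ ?_)
  simp only [Function.comp_apply]
  rw [norm_prod, Real.log_prod]
  intro n _
  exact norm_ne_zero_iff.2 (h.factor_ne_zero' hs n)

/-- Hence `log|ξ(s)| − log|ξ(s')| = ∑ₙ (log|1 − bₙ(2s−1)²| − log|1 − bₙ(2s'−1)²|)` for
`ξ(s), ξ(s') ≠ 0` — with `factor_eq_mul`, the termwise form
`∑_ρ log|(s−ρ)/(s'−ρ)|` (pairs `ρ, 1−ρ` grouped) behind Lehman's and Trudgian's `I₁`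
[Trudgian 2011, (2.17)]. [cite: Trudgian2011, §2.2 eq. (2.17)] -/
theorem hasSum_log_norm_factors_sub (h : IsHadamardSeq 0 b) {s s' : ℂ} (hs : riemannXi s ≠ 0)
    (hs' : riemannXi s' ≠ 0) :
    HasSum (fun n ↦ Real.log ‖1 - b n * (2 * s - 1) ^ 2‖ - Real.log ‖1 - b n * (2 * s' - 1) ^ 2‖)
      (Real.log ‖riemannXi s‖ - Real.log ‖riemannXi s'‖) := by
  have h1 := (h.hasSum_log_norm_factors hs).sub (h.hasSum_log_norm_factors hs')
  have e : Real.log ‖riemannXi s / riemannXi (1 / 2)‖ - Real.log ‖riemannXi s' / riemannXi (1 / 2)‖ =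
      Real.log ‖riemannXi s‖ - Real.log ‖riemannXi s'‖ := by
    rw [norm_div, norm_div, Real.log_div (norm_ne_zero_iff.2 hs)
        (norm_ne_zero_iff.2 riemannXi_one_half_ne_zero),
      Real.log_div (norm_ne_zero_iff.2 hs') (norm_ne_zero_iff.2 riemannXi_one_half_ne_zero)]
    ring
  rwa [e] at h1

/-- The terms of the partial-fraction series of `ξ'/ξ` are absolutely summable. [folklore] -/
theorem summable_logDeriv_riemannXi_terms (h : IsHadamardSeq 0 b) (s : ℂ) :
    Summable fun n ↦ -(4 * b n * (2 * s - 1)) / (1 - b n * (2 * s - 1) ^ 2) := by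
  have := (summable_logDeriv_terms h.summable (xiToH s)).mul_right (-2 * I)
  refine this.congr fun n ↦ ?_
  rw [xiToH_sq]
  simp only [xiToH]
  have hden : (1 + b n * -(2 * s - 1) ^ 2) = 1 - b n * (2 * s - 1) ^ 2 := by ring
  rw [hden]
  field_simp
  ring_nf
  rw [I_sq]
  ring

/-- **The partial-fraction series of `ξ'/ξ`**: at every `s` with `ξ(s) ≠ 0`,
`ξ'(s)/ξ(s) = ∑ₙ −4bₙ(2s−1)/(1 − bₙ(2s−1)²)` (`= ∑ₙ [1/(s−ρₙ) + 1/(s−(1−ρₙ))]`, see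
`logDeriv_riemannXi_eq_tsum_pairs`). [cite: Polymath2019, §3, proof of Prop. 3.1] -/
theorem logDeriv_riemannXi_eq_tsum (h : IsHadamardSeq 0 b) {s : ℂ} (hs : riemannXi s ≠ 0) :
    logDeriv riemannXi s = ∑' n, -(4 * b n * (2 * s - 1)) / (1 - b n * (2 * s - 1) ^ 2) := by
  have hfun : riemannXi = fun s ↦ 8 * (deBruijnH 0 ∘ xiToH) s :=
    funext fun s ↦ by rw [riemannXi_eq_deBruijnH]; rfl
  have hH : deBruijnH 0 (xiToH s) ≠ 0 := by
    intro h0; apply hs; rw [riemannXi_eq_deBruijnH, h0, mul_zero]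
  rw [hfun, logDeriv_const_mul _ (8 : ℂ) (by norm_num),
    logDeriv_comp ((differentiable_deBruijnH_holds 0).differentiableAt)
      (hasDerivAt_xiToH s).differentiableAt,
    (hasDerivAt_xiToH s).deriv, h.logDeriv_eq hH, ← tsum_mul_right]
  refine tsum_congr fun n ↦ ?_
  rw [xiToH_sq]
  simp only [xiToH]
  have hden : (1 + b n * -(2 * s - 1) ^ 2) = 1 - b n * (2 * s - 1) ^ 2 := by ring
  rw [hden]
  field_simp
  ring_nf
  rw [I_sq]
  ring


/-! ## The zeros: one per factor, `{ρₙ, 1 − ρₙ}` -/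

/-- A chosen zero `ρₙ = ½ + (1/(4bₙ))^{1/2}` for the `n`-th Hadamard factor
(`1 − bₙ(2s−1)² = −4bₙ (s − ρₙ)(s − (1−ρₙ))` when `bₙ ≠ 0`; junk `½ + 0^{1/2}` when `bₙ = 0`).
[folklore] -/
def xiZero (b : ℕ → ℂ) (n : ℕ) : ℂ := 1 / 2 + (1 / (4 * b n)) ^ (2⁻¹ : ℂ)

/-- `(ρₙ − ½)² = 1/(4bₙ)`. [folklore] -/
theorem xiZero_sub_half_sq (b : ℕ → ℂ) (n : ℕ) : (xiZero b n - 1 / 2) ^ 2 = 1 / (4 * b n) := by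
  simp only [xiZero, add_sub_cancel_left]
  exact Complex.cpow_ofNat_inv_pow _ 2

/-- The factorisation of the `n`-th Hadamard factor (`bₙ ≠ 0`). [folklore] -/
theorem factor_eq_mul (b : ℕ → ℂ) {n : ℕ} (hn : b n ≠ 0) (s : ℂ) :
    1 - b n * (2 * s - 1) ^ 2 = -4 * b n * ((s - xiZero b n) * (s - (1 - xiZero b n))) := by
  have hw := xiZero_sub_half_sq b n
  set ρ := xiZero b n
  have e : (s - ρ) * (s - (1 - ρ)) = (s - 1 / 2) ^ 2 - (ρ - 1 / 2) ^ 2 := by ring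
  rw [e, hw]
  field_simp
  ring

/-- The `n`-th term of `ξ'/ξ` is `1/(s − ρₙ) + 1/(s − (1−ρₙ))` (`bₙ ≠ 0`, `s ∉ {ρₙ, 1−ρₙ}`).
[folklore] -/
theorem term_eq_inv_add_inv (b : ℕ → ℂ) {n : ℕ} (hn : b n ≠ 0) {s : ℂ} (h1 : s ≠ xiZero b n)
    (h2 : s ≠ 1 - xiZero b n) :
    -(4 * b n * (2 * s - 1)) / (1 - b n * (2 * s - 1) ^ 2) =
      1 / (s - xiZero b n) + 1 / (s - (1 - xiZero b n)) := by
  have h1' : s - xiZero b n ≠ 0 := sub_ne_zero.2 h1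
  have h2' : s - (1 - xiZero b n) ≠ 0 := sub_ne_zero.2 h2
  rw [factor_eq_mul b hn]
  field_simp
  ring

/-- Each `ρₙ` with `bₙ ≠ 0` is a zero of `ξ`, i.e. a nontrivial zero of `ζ`
(`0 < Re ρₙ < 1`, `ζ(ρₙ) = 0`). [folklore] -/
theorem riemannXi_xiZero (h : IsHadamardSeq 0 b) {n : ℕ} (hn : b n ≠ 0) :
    riemannXi (xiZero b n) = 0 :=
  h.riemannXi_eq_zero_of_factor (n := n) (by rw [factor_eq_mul b hn]; ring)

/-- `ρₙ` (`bₙ ≠ 0`) is a nontrivial zero of `ζ`: `ζ(ρₙ) = 0` and `0 < Re ρₙ < 1`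
(`Literature.NumberTheory.LFunctions.riemannXi_eq_zero_iff_holds`). [folklore] -/
theorem riemannZeta_xiZero (h : IsHadamardSeq 0 b) {n : ℕ} (hn : b n ≠ 0) :
    riemannZeta (xiZero b n) = 0 ∧ 0 < (xiZero b n).re ∧ (xiZero b n).re < 1 :=
  (riemannXi_eq_zero_iff_holds _).1 (h.riemannXi_xiZero hn)

/-- … and so is `1 − ρₙ`. [folklore] -/
theorem riemannXi_one_sub_xiZero (h : IsHadamardSeq 0 b) {n : ℕ} (hn : b n ≠ 0) :
    riemannXi (1 - xiZero b n) = 0 := by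
  rw [riemannXi_one_sub, h.riemannXi_xiZero hn]

/-- **`ξ'/ξ` as a sum over the pairs of zeros**: at every `s` with `ξ(s) ≠ 0`,
`ξ'(s)/ξ(s) = ∑ₙ [1/(s−ρₙ) + 1/(s−(1−ρₙ))]` (the padding indices `bₙ = 0` contribute `0`), the
grouped form of `∑_ρ 1/(s−ρ)` over the nontrivial zeros of `ζ` (Davenport Ch. 12 (10) with the
constant `B` absorbed by the pairing `ρ ↔ 1−ρ`). [cite: Polymath2019, §3, proof of Prop. 3.1] -/
theorem logDeriv_riemannXi_eq_tsum_pairs (h : IsHadamardSeq 0 b) {s : ℂ} (hs : riemannXi s ≠ 0) :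
    logDeriv riemannXi s =
      ∑' n, if b n = 0 then 0 else 1 / (s - xiZero b n) + 1 / (s - (1 - xiZero b n)) := by
  rw [h.logDeriv_riemannXi_eq_tsum hs]
  refine tsum_congr fun n ↦ ?_
  split_ifs with hn
  · simp [hn]
  · refine term_eq_inv_add_inv b hn (fun e ↦ hs ?_) (fun e ↦ hs ?_)
    · rw [e]; exact h.riemannXi_xiZero hn
    · rw [e]; exact h.riemannXi_one_sub_xiZero hn

/-- The pair terms are absolutely summable. [folklore] -/
theorem summable_pairs (h : IsHadamardSeq 0 b) {s : ℂ} (hs : riemannXi s ≠ 0) :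
    Summable fun n ↦ if b n = 0 then (0 : ℂ) else 1 / (s - xiZero b n) + 1 / (s - (1 - xiZero b n)) := by
  refine (h.summable_logDeriv_riemannXi_terms s).congr fun n ↦ ?_
  split_ifs with hn
  · simp [hn]
  · refine term_eq_inv_add_inv b hn (fun e ↦ hs ?_) (fun e ↦ hs ?_)
    · rw [e]; exact h.riemannXi_xiZero hn
    · rw [e]; exact h.riemannXi_one_sub_xiZero hn

/-- **Real part**: `Re ξ'(s)/ξ(s) = ∑ₙ Re [1/(s−ρₙ) + 1/(s−(1−ρₙ))]` at every `s` with `ξ(s) ≠ 0`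
(the form used by Lehman 1970 §4 and Trudgian 2011 §2.2: `∑_ρ Re 1/(s−ρ)`).
[cite: Trudgian2011, §2.2, after (2.17)] -/
theorem re_logDeriv_riemannXi_eq_tsum (h : IsHadamardSeq 0 b) {s : ℂ} (hs : riemannXi s ≠ 0) :
    (logDeriv riemannXi s).re =
      ∑' n, if b n = 0 then (0 : ℝ) else
        (1 / (s - xiZero b n)).re + (1 / (s - (1 - xiZero b n))).re := by
  rw [h.logDeriv_riemannXi_eq_tsum_pairs hs, Complex.re_tsum (h.summable_pairs hs)]
  refine tsum_congr fun n ↦ ?_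
  split_ifs <;> simp

/-- The real part of `1/(s − ρ)`: `Re 1/(s−ρ) = (σ − β)/|s−ρ|²`; in particular it is positive
for `σ > β`. [folklore] -/
theorem re_inv_sub_eq (s ρ : ℂ) : (1 / (s - ρ)).re = (s.re - ρ.re) / ‖s - ρ‖ ^ 2 := by
  rw [one_div, Complex.inv_re, Complex.normSq_eq_norm_sq, sub_re]

/-- `Re 1/(s−ρ) > 0` when `Re s > Re ρ`. [folklore] -/
theorem re_inv_sub_pos {s ρ : ℂ} (h : ρ.re < s.re) : 0 < (1 / (s - ρ)).re := by
  rw [re_inv_sub_eq]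
  have : s - ρ ≠ 0 := fun e ↦ by
    have := congrArg Complex.re e; simp at this; linarith
  exact div_pos (by linarith) (by positivity)

end IsHadamardSeq


/-! ## Conjugation symmetry of the Hadamard multiset (for any `t`) -/

namespace IsHadamardSeq

variable {t : ℝ} {b : ℕ → ℂ}


/-- The fibre of a non-zero value `a` of a Hadamard sequence is the set of indices of the factors
vanishing at a square root `z₁` of `−1/a`. [folklore] -/
theorem setOf_eq_eq_zeroIndices (h : IsHadamardSeq t b) {a z₁ : ℂ} (ha : a ≠ 0)
    (hz : z₁ ^ 2 = -1 / a) : {n : ℕ | b n = a} = (h.zeroIndices z₁ : Set ℕ) := by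
  ext n
  simp only [Set.mem_setOf_eq, Finset.mem_coe, h.mem_zeroIndices, hz]
  constructor
  · intro hn; rw [hn]; field_simp; ring
  · intro hn
    have : b n * (-1 / a) = -1 := by linear_combination hn
    field_simp at this
    linear_combination -this

/-- `H_t` has the same order of vanishing at `z̄₁` as at `z₁` (`H_t(z̄) = conj H_t(z)`).
[folklore] -/
theorem analyticOrderAt_deBruijnH_conj (t : ℝ) (z₁ : ℂ) :
    analyticOrderAt (deBruijnH t) (conj z₁) = analyticOrderAt (deBruijnH t) z₁ := by
  have hf : AnalyticAt ℂ (deBruijnH t) (conj z₁) :=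
    (differentiable_deBruijnH_holds t).analyticAt _
  have h1 := analyticOrderAt_conj_conj hf
  have e : (fun z ↦ conj (deBruijnH t (conj z))) = deBruijnH t := by
    funext z; rw [deBruijnH_conj, Complex.conj_conj]
  rw [e] at h1
  exact h1.symm

/-- The multiplicity function of a Hadamard sequence is conjugation invariant. [folklore] -/
theorem mult_conj (h : IsHadamardSeq t b) (z₁ : ℂ) : h.mult (conj z₁) = h.mult z₁ := by
  by_cases hz : deBruijnH t z₁ = 0
  · have hz' : deBruijnH t (conj z₁) = 0 := by rw [deBruijnH_conj, hz, map_zero]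
    have := analyticOrderAt_deBruijnH_conj t z₁
    rw [h.analyticOrderAt_eq_mult hz', h.analyticOrderAt_eq_mult hz] at this
    exact_mod_cast this
  · have hz' : deBruijnH t (conj z₁) ≠ 0 := by rwa [deBruijnH_conj, map_ne_zero_iff _ (RingHom.injective _)]
    have e1 : h.zeroIndices z₁ = ∅ :=
      Finset.eq_empty_of_forall_notMem fun n hn ↦ h.factor_ne_zero hz n (h.mem_zeroIndices.1 hn)
    have e2 : h.zeroIndices (conj z₁) = ∅ :=
      Finset.eq_empty_of_forall_notMem fun n hn ↦ h.factor_ne_zero hz' n (h.mem_zeroIndices.1 hn)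
    simp [mult, e1, e2]

/-- **Conjugation symmetry of the Hadamard multiset**: there is a permutation `π` of the indices
with `b (π n) = conj (b n)` for all `n` (the non-zero values of `b` are the `−1/z₁²`, `z₁` a zero
of `H_t`, each taken `ord_{z₁} H_t` times, and `ord_{z̄₁} = ord_{z₁}`). [folklore] -/
theorem exists_perm_eq_conj (h : IsHadamardSeq t b) : ∃ π : ℕ ≃ ℕ, ∀ n, b (π n) = conj (b n) := by
  -- fibre equivalences between `b' = conj ∘ b` and `b`
  set b' : ℕ → ℂ := fun n ↦ conj (b n) with hb'
  have e : ∀ a : ℂ, {n : ℕ // b' n = a} ≃ {n : ℕ // b n = a} := by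
    intro a
    by_cases ha : a = 0
    · refine Equiv.subtypeEquivRight fun n ↦ ?_
      simp [hb', ha]
    · -- both fibres are finite with the same cardinality
      have hca : conj a ≠ 0 := by rwa [map_ne_zero_iff _ (RingHom.injective _)]
      set z₁ : ℂ := (-1 / a) ^ (2⁻¹ : ℂ) with hz₁
      have hz : z₁ ^ 2 = -1 / a := Complex.cpow_ofNat_inv_pow _ 2
      have hzc : (conj z₁) ^ 2 = -1 / conj a := by
        rw [← map_pow, hz, map_div₀, map_neg, map_one]
      have s1 : {n : ℕ | b n = a} = (h.zeroIndices z₁ : Set ℕ) := h.setOf_eq_eq_zeroIndices ha hz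
      have s2 : {n : ℕ | b' n = a} = (h.zeroIndices (conj z₁) : Set ℕ) := by
        have : {n : ℕ | b' n = a} = {n : ℕ | b n = conj a} := by
          ext n; simp only [Set.mem_setOf_eq, hb']
          constructor
          · intro hn; rw [← hn, Complex.conj_conj]
          · intro hn; rw [hn, Complex.conj_conj]
        rw [this]
        exact h.setOf_eq_eq_zeroIndices hca hzc
      haveI : Finite {n : ℕ | b n = a} := by rw [s1]; exact Finite.of_fintype _
      haveI : Finite {n : ℕ | b' n = a} := by rw [s2]; exact Finite.of_fintype _
      have hcard : Nat.card {n : ℕ | b' n = a} = Nat.card {n : ℕ | b n = a} := by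
        rw [Nat.card_congr (Equiv.setCongr s1), Nat.card_congr (Equiv.setCongr s2),
          Nat.card_eq_card_toFinset, Nat.card_eq_card_toFinset]
        simp only [Finset.toFinset_coe]
        exact h.mult_conj z₁
      exact (Finite.card_eq.1 hcard).some
  refine ⟨Equiv.ofFiberEquiv e, fun n ↦ ?_⟩
  have := Equiv.ofFiberEquiv_map e n
  -- `this : b (π n) = b' n`
  simpa [hb'] using this

/-- Re-indexing a sum over the Hadamard multiset by conjugation: for any `G`,
`∑ₙ G(bₙ) = ∑ₙ G(conj bₙ)`. [folklore] -/
theorem tsum_comp_conj_eq {α : Type*} [AddCommMonoid α] [TopologicalSpace α]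
    (h : IsHadamardSeq t b) (G : ℂ → α) :
    ∑' n, G (conj (b n)) = ∑' n, G (b n) := by
  obtain ⟨π, hπ⟩ := h.exists_perm_eq_conj
  have := Equiv.tsum_eq π (fun n ↦ G (b n))
  simp only [hπ] at this
  exact this

end IsHadamardSeq

end Literature.NumberTheory.LFunctions
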